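import Summits.BirchSwinnertonDyer.Rank1Residual.AdditivePotMult.RankZeroShaAnIdentity
import Literature.NumberTheory.EllipticCurves.Rank1Residual.Typed.Basic
import HarnessLib

/-!
# Route `PrintX9`, the Assembly's SQUEEZE kernels at a Heegner datum: Tamagawa-sharp UPPER bound over
# `K` + the cyclotomic LOWER half at the twist ⟹ the Euler-system half `ord_p #Ш(E) ≤ ord_p #Ш(E)_an`
# over `ℚ`, in BOTH analytic ranks (cell `bsd-print-x9`, unit `bsd-print-x9-p4`, item 20394)

HONEST FRAMING (cell `bsd-print-x9`, HOME `run/shared/lean/pub/bsd-print-x9/`): route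
`route-BirchSwinnertonDyer-PrintX9` closes the W-ALL/9 corner `Summit.BirchSwinnertonDyer.WAllCornerX9`
from its items J (`HeegnerDivisibilityX9`, 20392), Mu (`AnalyticMuZeroX9`, 19630), Sch
(`SchneiderX9RankOne`, 19631) and two PUBLISHED bundles (20393, 19632) through the `Assembly` (20394).
THIS FILE proves the two pieces of pure BSD bookkeeping the Assembly's squeeze needs, THEOREMS ONLY, no
named fact introduced, nothing booked: at a Heegner datum `(K, Dt, H, ι, P)` for a globally minimal
`W/ℚ` of conductor `N` and an odd prime `p` with `p ∤ c(Dt)·#𝓞_K^×`, and a globally minimal model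
`Wd = Cd • W^{(d_K)}` of the twist with `ord_p u(Cd) = 0` and `ord_p ∏c(Wd) = ord_p ∏c(W)`:

* `X9.missingUpperBoundAt_rankOne_of_sharpUpper_of_twistLower` — `ord_{s=1} L(E,s) = 1`,
  `L(E^{d_K},1) ≠ 0`: the Tamagawa-SHARP upper bound over `K`
  `ord_p #Ш(E/K) + 2·ord_p ∏c(E) ≤ 2·ord_p [E(K):ℤP]` (Cha 2005 Rmk. 25 fed by J — the tree's
  `X9.shaIndexBound_sharp_of_globalDivisibility`) and the LOWER half `ord_p #Ш(E^K)_an ≤ ord_p #Ш(E^K)`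
  at the rank-`0` twist (`Typed.MissingLowerBoundAt Wd p`) give the UPPER half
  `ord_p #Ш(E) ≤ ord_p #Ш(E)_an` (`Typed.MissingUpperBoundAt W p`), by the Gross–Zagier /
  Jetchev–Skinner–Wan §7.4 valuation identity `X11b.exists_shaAn_padicVal_eq_of_heegner`
  (`ord_p #Ш(E)_an + ord_p (L(E^K,1)/Ω) + ord_p ∏c(E) + 2 ord_p #E^K(ℚ)_tors = 2 ord_p [E(K):ℤP]`) and
  `Ш(E/K)[p^∞] = Ш(E)[p^∞] ⊕ Ш(E^K)[p^∞]`.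
* `X9.missingUpperBoundAt_rankZero_of_sharpUpper_of_twistLower` — `ord_{s=1} L(E,s) = 0`, the twist of
  analytic rank `1`: the same squeeze with the curves exchanged, by the MINUS-part identity
  `AdditivePotMult.exists_shaAn_padicVal_eq_of_heegner_rankZero`.

The arithmetic (rank `1`; `a = ord_p #Ш(E)`, `b = ord_p #Ш(E^K)`, `t = ord_p ∏c(E) = ord_p ∏c(E^K)`,
`I = ord_p [E(K):ℤP]`): `ord_p #Ш(E)_an = 2I − ord_p #Ш(E^K)_an − 2t ≥ (a + b + 2t) − b − 2t = a`.
No new mathematics: Jetchev–Skinner–Wan 2017 §7.4.2 ("the upper bound") read with an inequality at the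
twist instead of Skinner–Urban's equality.

References: [JetchevSkinnerWan2017] §7.4.1–§7.4.3 (pp. 29–31); [GrossZagier1986] V.§2 (pp. 310–312);
[Cha2005] Thm. 21, Rmk. 25; [Miller2011LMS] §1, Def. 1.1.
-/

set_option autoImplicit false
set_option linter.dupNamespace false

noncomputable section

open scoped Classical

open WeierstrassCurve NumberField Literature.NumberTheory.EllipticCurves
  Literature.NumberTheory.EllipticCurves.ModularForms
  Literature.NumberTheory.EllipticCurves.Rank1Residual
  Summit.BirchSwinnertonDyer.Rank1Residual

namespace Summit.BirchSwinnertonDyer.BirchSwinnertonDyer.Rank1Residual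

/-! ### §0 Analytic rank zero: `#Ш(E)_an = (L(E,1)/Ω_E)·#E(ℚ)_tors²/∏c`, read backwards -/

/-- In analytic rank `0` (so `Reg = 1` by Gross–Zagier–Kolyvagin), if `#Ш(V)_an = q ∈ ℚ` then
`L(V,1)/Ω_V = q·∏_ℓ c_ℓ(V)/#V(ℚ)_tors²` and `q ≠ 0` (`L(V,1) ≠ 0`, modularity). Bookkeeping on the
definition `shaAn`. [cite: Miller2011LMS, §1 (arXiv:1010.2431 p. 3)] -/
theorem X9.centralValue_div_period_eq_of_shaAn_eq
    (hGZK : rank_eq_analyticRank_of_analyticRank_le_one) (hmod : hasEntireLFunction_rat)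
    (V : WeierstrassCurve ℚ) [V.IsElliptic] [V.IsGloballyMinimal] (hr : V.analyticRank = 0)
    {q : ℚ} (hq : shaAn V = (q : ℂ)) :
    V.entireLFunction 1 / (V.realPeriodRat : ℂ) =
        ((q * (V.tamagawaProduct : ℚ) / (V.torsionOrder : ℚ) ^ 2 : ℚ) : ℂ) ∧ q ≠ 0 := by
  have hr0 : V.mordellWeilRank = 0 := (hGZK V (by omega)).1.trans hr
  have hReg : V.regulator = 1 := V.regulator_eq_one_of_rank_zero hr0
  have hΩ : (V.realPeriodRat : ℂ) ≠ 0 := Complex.ofReal_ne_zero.mpr V.realPeriodRat_pos_holds.ne'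
  have hc : (V.tamagawaProduct : ℂ) ≠ 0 := by exact_mod_cast V.tamagawaProduct_pos_holds.ne'
  have ht : (V.torsionOrder : ℂ) ≠ 0 := by exact_mod_cast V.torsionOrder_pos_holds.ne'
  have hL1 : V.entireLFunction 1 ≠ 0 := (V.analyticRank_eq_zero_iff_holds (hmod V)).1 hr
  rw [shaAn_def, V.leadingLCoeff_eq_of_analyticRank_eq_zero hr, hReg] at hq
  push_cast at hq ⊢
  rw [mul_one] at hq
  have key : V.entireLFunction 1 / (V.realPeriodRat : ℂ) =
      (q : ℂ) * (V.tamagawaProduct : ℂ) / (V.torsionOrder : ℂ) ^ 2 := by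
    rw [← hq]
    field_simp
  refine ⟨key, ?_⟩
  rintro rfl
  apply div_ne_zero hL1 hΩ
  rw [key]
  simp

/-! ### §1 Analytic rank one: sharp UPPER over `K` + LOWER at the rank-zero twist ⟹ UPPER over `ℚ` -/

/-- **Rank one, the squeeze.** Data as in `X11b.exists_shaAn_padicVal_eq_of_heegner` (`W` globally
minimal of conductor `N`, `ord_{s=1}L(E,s) = 1`, `K` imaginary quadratic with the Heegner hypothesis
for `N`, `L(E^{d_K},1) ≠ 0`, `P` the Heegner point of `Dt` with `p ∤ c(Dt)`, `p` odd, `p ∤ #𝓞_K^×`,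
`Wd = Cd • E^{(d_K)}` globally minimal with `ord_p u(Cd) = 0` and `ord_p ∏c(Wd) = ord_p ∏c(W)`), PLUS
the Tamagawa-sharp UPPER bound over `K` (`hU`: `ord_p #Ш(E/K) + 2·ord_p ∏c(E) ≤ 2·ord_p [E(K):ℤP]`,
Cha 2005 Rmk. 25 ∘ Heegner divisibility) and the LOWER half at the twist (`hlow`:
`ord_p #Ш(E^K)_an ≤ ord_p #Ш(E^K)`). CONCLUSION: `ord_p #Ш(E) ≤ ord_p #Ш(E)_an`
(`Typed.MissingUpperBoundAt W p`). PUBLISHED binders: Gross–Zagier (`hGZ`), Kolyvagin (`hKo`), GZK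
(`hGZK`), modularity (`hmod`). [cite: JetchevSkinnerWan2017, §7.4.2–7.4.3 (pp. 30–31)]
[cite: GrossZagier1986, V.§2 (pp. 310–312)] [cite: Miller2011LMS, Def. 1.1] -/
theorem X9.missingUpperBoundAt_rankOne_of_sharpUpper_of_twistLower
    (W : WeierstrassCurve ℚ) [W.IsElliptic] [W.IsGloballyMinimal] (p : ℕ) [Fact p.Prime]
    (N : ℕ) [NeZero N] (K : Type) [Field K] [NumberField K]
    (Dt : ModularParametrizationData W N) (H : HeegnerDatum N (NumberField.discr K)) (ι : K →+* ℂ)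
    (P : (W.baseChange K).toAffine.Point)
    (hGZ : gross_zagier N W K) (hKo : kolyvagin N W K)
    (hGZK : rank_eq_analyticRank_of_analyticRank_le_one) (hmod : hasEntireLFunction_rat)
    (hK : IsImaginaryQuadratic K) (hHN : SatisfiesHeegnerHypothesis N K)
    (hP : WeierstrassCurve.Affine.Point.map ι.toRatAlgHom P = heegnerPointComplex Dt H)
    (hp2 : p ≠ 2) (hc : ¬ (p : ℤ) ∣ Dt.c) (hμ : ¬ p ∣ Units.torsionOrder K)
    (hr : W.analyticRank = 1)
    (hLt : (W.quadraticTwist (NumberField.discr K : ℚ)).entireLFunction 1 ≠ 0)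
    (Wd : WeierstrassCurve ℚ) [Wd.IsElliptic] [Wd.IsGloballyMinimal] (Cd : VariableChange ℚ)
    (hWd : Cd • W.quadraticTwist (NumberField.discr K : ℚ) = Wd)
    (hu : padicValRat p (Cd.u : ℚ) = 0)
    (htam : padicValNat p Wd.tamagawaProduct = padicValNat p W.tamagawaProduct)
    (hU : padicValNat p (Nat.card (W.baseChange K).sha) + 2 * padicValNat p W.tamagawaProduct ≤
      2 * padicValNat p (AddSubgroup.zmultiples P).index)
    (hlow : Typed.MissingLowerBoundAt Wd p) :
    Typed.MissingUpperBoundAt W p := by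
  have hD0 : (NumberField.discr K : ℚ) ≠ 0 := by exact_mod_cast NumberField.discr_ne_zero K
  haveI hEt : (W.quadraticTwist (NumberField.discr K : ℚ)).IsElliptic :=
    W.isElliptic_quadraticTwist hD0
  -- the twist has analytic rank `0`
  have hLt' : (W.quadraticTwist (NumberField.discr K : ℚ)).entireLFunction = Wd.entireLFunction := by
    rw [← hWd, entireLFunction_smul]
  have hLd1 : Wd.entireLFunction 1 ≠ 0 := by rw [← hLt']; exact hLt
  have hrd : Wd.analyticRank = 0 := (Wd.analyticRank_eq_zero_iff_holds (hmod Wd)).2 hLd1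
  -- the twist's central value from its `#Ш_an`
  obtain ⟨q', hq', hle'⟩ := hlow
  obtain ⟨hqd, hq'0⟩ := X9.centralValue_div_period_eq_of_shaAn_eq hGZK hmod Wd hrd hq'
  -- the Gross–Zagier / JSW §7.4 identity
  obtain ⟨-, -, hsha, q, hq, hval⟩ := X11b.exists_shaAn_padicVal_eq_of_heegner W p N K Dt H ι P hGZ
    hKo hGZK hmod hK hHN hP hp2 hc hμ hr hLt Wd Cd hWd hu _ hqd
  refine ⟨q, hq, ?_⟩
  -- valuations
  have hcd : (Wd.tamagawaProduct : ℚ) ≠ 0 := by exact_mod_cast Wd.tamagawaProduct_pos_holds.ne'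
  have htd : (Wd.torsionOrder : ℚ) ≠ 0 := by exact_mod_cast Wd.torsionOrder_pos_holds.ne'
  have hvqd : padicValRat p (q' * (Wd.tamagawaProduct : ℚ) / (Wd.torsionOrder : ℚ) ^ 2) =
      padicValRat p q' + padicValNat p Wd.tamagawaProduct - 2 * padicValNat p Wd.torsionOrder := by
    rw [padicValRat.div (mul_ne_zero hq'0 hcd) (pow_ne_zero _ htd), padicValRat.mul hq'0 hcd,
      padicValRat.pow, padicValRat.of_nat, padicValRat.of_nat]
    ring
  rw [hvqd] at hval
  simp only [WeierstrassCurve.shaOrder] at hsha hle' ⊢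
  have e1 := hU
  have e2 := hsha
  have e3 := htam
  have e4 := hle'
  omega

/-! ### §2 Analytic rank zero: sharp UPPER over `K` + LOWER at the rank-one twist ⟹ UPPER over `ℚ` -/

/-- **Rank zero, the squeeze (curves exchanged).** Data as in
`AdditivePotMult.exists_shaAn_padicVal_eq_of_heegner_rankZero` (`ord_{s=1}L(E,s) = 0`, the twist
`Wd = Cd • E^{(d_K)}` globally minimal of analytic rank `1`, `ord_p u(Cd) = 0`,
`ord_p ∏c(Wd) = ord_p ∏c(W)`, `p` odd, `p ∤ c(Dt)·#𝓞_K^×`), PLUS the Tamagawa-sharp UPPER bound over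
`K` (`hU`), the LOWER half at the rank-`1` twist (`hlowd`: `ord_p #Ш(E^K)_an ≤ ord_p #Ш(E^K)`) and
rationality of `#Ш(E)_an` (`hrat`). CONCLUSION: `ord_p #Ш(E) ≤ ord_p #Ш(E)_an`
(`Typed.MissingUpperBoundAt W p`). The Heegner point lies in the minus part; the height bookkeeping is
the tree's `exists_mul_canonicalHeight_eq_index_sq_mul_regulator_twist`.
[cite: JetchevSkinnerWan2017, §7.4.1–7.4.3 (pp. 29–31)] [cite: GrossZagier1986, V.§2 (pp. 310–312)]
[cite: Miller2011LMS, Def. 1.1] -/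
theorem X9.missingUpperBoundAt_rankZero_of_sharpUpper_of_twistLower
    (W : WeierstrassCurve ℚ) [W.IsElliptic] [W.IsGloballyMinimal] (p : ℕ) [Fact p.Prime]
    (N : ℕ) [NeZero N] (K : Type) [Field K] [NumberField K]
    (Dt : ModularParametrizationData W N) (H : HeegnerDatum N (NumberField.discr K)) (ι : K →+* ℂ)
    (P : (W.baseChange K).toAffine.Point)
    (hGZ : gross_zagier N W K) (hKo : kolyvagin N W K)
    (hGZK : rank_eq_analyticRank_of_analyticRank_le_one) (hmod : hasEntireLFunction_rat)
    (hK : IsImaginaryQuadratic K) (hHN : SatisfiesHeegnerHypothesis N K)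
    (hP : WeierstrassCurve.Affine.Point.map ι.toRatAlgHom P = heegnerPointComplex Dt H)
    (hp2 : p ≠ 2) (hc : ¬ (p : ℤ) ∣ Dt.c) (hμ : ¬ p ∣ Units.torsionOrder K)
    (hr : W.analyticRank = 0)
    (Wd : WeierstrassCurve ℚ) [Wd.IsElliptic] [Wd.IsGloballyMinimal] (Cd : VariableChange ℚ)
    (hWd : Cd • W.quadraticTwist (NumberField.discr K : ℚ) = Wd)
    (hu : padicValRat p (Cd.u : ℚ) = 0) (hrd : Wd.analyticRank = 1)
    (htam : padicValNat p Wd.tamagawaProduct = padicValNat p W.tamagawaProduct)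
    (hU : padicValNat p (Nat.card (W.baseChange K).sha) + 2 * padicValNat p W.tamagawaProduct ≤
      2 * padicValNat p (AddSubgroup.zmultiples P).index)
    (hlowd : Typed.MissingLowerBoundAt Wd p) (hrat : ∃ qW : ℚ, shaAn W = (qW : ℂ)) :
    Typed.MissingUpperBoundAt W p := by
  -- the curve's central value from its `#Ш_an`
  obtain ⟨qW, hqW⟩ := hrat
  obtain ⟨hq0, hqW0⟩ := X9.centralValue_div_period_eq_of_shaAn_eq hGZK hmod W hr hqW
  -- the minus-part Gross–Zagier / JSW §7.4 identity
  obtain ⟨-, -, hsha, q, hq, hval⟩ := AdditivePotMult.exists_shaAn_padicVal_eq_of_heegner_rankZero W p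
    N K Dt H ι P hGZ hKo hGZK hmod hK hHN hP hp2 hc hμ hr Wd Cd hWd hu hrd _ hq0
  -- the lower half at the twist reads on the same rational
  obtain ⟨q'', hq'', hle''⟩ := hlowd
  have hqq : q'' = q := by exact_mod_cast hq''.symm.trans hq
  subst hqq
  refine ⟨qW, hqW, ?_⟩
  have hcW : (W.tamagawaProduct : ℚ) ≠ 0 := by exact_mod_cast W.tamagawaProduct_pos_holds.ne'
  have htW : (W.torsionOrder : ℚ) ≠ 0 := by exact_mod_cast W.torsionOrder_pos_holds.ne'
  have hvq0 : padicValRat p (qW * (W.tamagawaProduct : ℚ) / (W.torsionOrder : ℚ) ^ 2) =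
      padicValRat p qW + padicValNat p W.tamagawaProduct - 2 * padicValNat p W.torsionOrder := by
    rw [padicValRat.div (mul_ne_zero hqW0 hcW) (pow_ne_zero _ htW), padicValRat.mul hqW0 hcW,
      padicValRat.pow, padicValRat.of_nat, padicValRat.of_nat]
    ring
  rw [hvq0] at hval
  simp only [WeierstrassCurve.shaOrder] at hsha hle'' ⊢
  have e1 := hU
  have e2 := hsha
  have e3 := htam
  have e4 := hle''
  omega

end Summit.BirchSwinnertonDyer.BirchSwinnertonDyer.Rank1Residual

end
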